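import Mathlib
import Summits.PneNP.PneNP.Theorems.LatticeMagicBooleanSosBlindAtConstantFactorDefs
import Literature.Algebra.EuclideanLattices.EncodingProofs

/-!
# PneNP / LatticeMagic — `BooleanSosBlindAtConstantFactor`, line `Sketch`: stub `stub_encode`

Helper file for the crux `BooleanSosBlindAtConstantFactor` (item `stmt-PneNP-2330`, `--supports`;
closes nothing by itself). It proves the stub `stub_encode` of the line `Sketch` (Construction-A
road): the bit-code of the Construction-A `GapCVP` instance `conAInstance N me C (K : ℚ)`
(vocabulary of `LatticeMagicBooleanSosBlindAtConstantFactorDefs.lean`: dimension `n = N + me`, basis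
`conABasis N me C` with entries in `{0, 1, 2}`, target `conATarget N me C` with entries in `{0, 1}`,
rational threshold `K` with numerator `K` and denominator `1`) has length

  `|code (conAInstance N me C K)| ≤ c · ((N + me + 1)² + ⌊log₂ K⌋ + 1)`

for an absolute constant `c` (we take `c = 100`), i.e. polynomial in the dimension and the bit
length of the threshold — the instance of "the size of the input of a lattice problem is the number
of bits of the integer data" for this family.

**Proof.** Pure length bookkeeping on the Boolean encodings fixed in
`Literature/Algebra/EuclideanLattices/Encoding.lean` (`gapCVPInstanceEncoding =
cvpInstanceEncoding.pairBool encodingRatBool`): definitionally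
`code ((⟨n, B⟩, t), d) = ⟨⟨bin n, ⟨code B, code t⟩⟩, ⟨encodeInt d.num, bin d.den⟩⟩` with the
self-delimiting pairing `|⟨x, y⟩| = 2|x| + 2 + |y|` (`length_boolPair`). The `listBool` codes of
the `n²` basis entries and the `n` target entries cost
`2 · (#entries) + 2 + Σ (2 |encodeInt e| + 2)` bits with `|encodeInt e| ≤ ⌊log₂ |e|⌋ + 7 ≤ |e| + 7`
(`length_encodeInt_le_holds` of `EncodingProofs.lean`), the header costs
`|bin n| ≤ ⌊log₂ n⌋ + 3 ≤ n + 3`, and the threshold `2 (⌊log₂ K⌋ + 7) + 3`; summing,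
`|code| ≤ 88 n² + 44 n + 2 ⌊log₂ K⌋ + 51 ≤ 100 ((n + 1)² + ⌊log₂ K⌋ + 1)`.

Sources: D. Micciancio, S. Goldwasser, *Complexity of Lattice Problems: A Cryptographic
Perspective* (Kluwer 2002), Ch. 1, §1.3 ("size of the input": the number of bits of the integer
basis, target and threshold); S. Arora, B. Barak, *Computational Complexity: A Modern Approach*
(CUP 2009), §0.1 (representing integers, tuples and matrices as strings). Nothing is cited as a
fact: everything here is proved from the tree's encoders. Deliberately NOT here: the other stubs of
the line (`stub_no`, `stub_parity`, `stub_fooled`) and the composition.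
-/

set_option linter.dupNamespace false -- summit = sub-problem (D-0017)

namespace Summit.PneNP.PneNP.Theorems.ConA

open Computability Literature.Algebra.EuclideanLattices Literature.Computability.Complexity
  Literature.Computability.MetaComplexity

/-! ### Lengths of the building blocks (bookkeeping after `EncodingProofs.lean`) -/

/-- `|unaryEncodeNat k| = k` (Mathlib's unary numeral). [folklore] -/
private theorem stubEncode_length_unaryEncodeNat (k : ℕ) : (unaryEncodeNat k).length = k := by
  induction k with
  | zero => rfl
  | succ k ih => simp [unaryEncodeNat, ih]

/-- Length of a `listBool` code: unary length header, then each component `boolPair`-framed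
(`2 |e a| + 2` bits each); the private lemma `length_listBool_encode` of `EncodingProofs.lean`,
re-proved here (Arora–Barak 2009, §0.1, tuples of strings). [folklore] -/
private theorem stubEncode_length_listBool_encode {α : Type} (e : Encoding α Bool) (l : List α) :
    (e.listBool.encode l).length =
      2 * l.length + 2 + (l.map fun a => 2 * (e.encode a).length + 2).sum := by
  have H : ∀ l : List α, (l.foldr (fun a acc => boolPair (e.encode a) acc) []).length
      = (l.map fun a => 2 * (e.encode a).length + 2).sum := by
    intro l
    induction l with
    | nil => rfl
    | cons a l ih =>
      simp only [List.foldr_cons, length_boolPair, ih, List.map_cons, List.sum_cons]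
  simp only [Encoding.listBool, length_boolPair, stubEncode_length_unaryEncodeNat, H]

/-- A list sum of `B`-bounded terms is at most `|l| · B`. [folklore] -/
private theorem stubEncode_sum_map_le {α : Type} (l : List α) (f : α → ℕ) (B : ℕ)
    (h : ∀ a ∈ l, f a ≤ B) : (l.map f).sum ≤ l.length * B := by
  induction l with
  | nil => simp
  | cons a l ih =>
    simp only [List.map_cons, List.sum_cons, List.length_cons]
    have ha : f a ≤ B := h a (by simp)
    have hl : (l.map f).sum ≤ l.length * B := ih fun b hb => h b (by simp [hb])
    nlinarith [ha, hl]

/-- The `listBool` code of `List.ofFn v` (`v : Fin m → ℤ`) with entries of absolute value `≤ M` has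
length `≤ 2 m + 2 + m (2 M + 16)`: each framed entry costs `2 |encodeInt z| + 2` bits with
`|encodeInt z| ≤ ⌊log₂ |z|⌋ + 7 ≤ M + 7` (`length_encodeInt_le_holds`; Arora–Barak 2009, §0.1).
[folklore] -/
private theorem stubEncode_length_listBool_ofFn_le {m : ℕ} (v : Fin m → ℤ) (M : ℕ)
    (hv : ∀ k, (v k).natAbs ≤ M) :
    (encodingIntBool.listBool.encode (List.ofFn v)).length ≤ 2 * m + 2 + m * (2 * M + 16) := by
  rw [stubEncode_length_listBool_encode, List.length_ofFn]
  refine Nat.add_le_add_left ?_ _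
  have h := stubEncode_sum_map_le (List.ofFn v) (fun a => 2 * (encodingIntBool.encode a).length + 2)
    (2 * M + 16) (by
      intro a ha
      obtain ⟨k, rfl⟩ := List.mem_ofFn.1 ha
      have h1 : (encodeInt (v k)).length ≤ Nat.log 2 (v k).natAbs + 7 := length_encodeInt_le_holds _
      have h2 := Nat.log_le_self 2 (v k).natAbs
      have h3 := hv k
      change 2 * (encodeInt (v k)).length + 2 ≤ _
      omega)
  rwa [List.length_ofFn] at h

/-- `|encodeNat m| ≤ ⌊log₂ m⌋ + 3`, read off `|encodeInt m| = |encodeNat m| + 4 ≤ ⌊log₂ m⌋ + 7`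
(`length_encodeInt_eq`, `length_encodeInt_le_holds`; Arora–Barak 2009, §0.1). [folklore] -/
private theorem stubEncode_length_encodeNat_le (m : ℕ) :
    (encodeNat m).length ≤ Nat.log 2 m + 3 := by
  have h1 := length_encodeInt_eq (m : ℤ)
  have h2 : (encodeInt (m : ℤ)).length ≤ Nat.log 2 (m : ℤ).natAbs + 7 :=
    length_encodeInt_le_holds _
  rw [Int.natAbs_natCast] at h1 h2
  omega

/-! ### The pieces of the Construction-A code -/

/-- Unfolding the code of `conAInstance N me C d` into its `boolPair` fields:
`⟨⟨bin (N + me), ⟨code conABasis, code conATarget⟩⟩, code d⟩` (definitional; Micciancio–Goldwasser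
2002, Ch. 1, §1.2, the data of a `GapCVP` instance). [folklore] -/
private theorem stubEncode_encode_eq (N me : ℕ) (C : Fin me → Clause ℕ) (d : ℚ) :
    GapCVPInstance.encode (conAInstance N me C d) =
      boolPair (boolPair (encodeNat (N + me))
        (boolPair ((encodingIntMatrixFin (N + me)).encode (conABasis N me C))
          ((encodingIntVecFin (N + me)).encode (conATarget N me C))))
        (encodingRatBool.encode d) :=
  rfl

/-- The code of the natural threshold `K` as a rational: numerator `K`, denominator `1`
(`Rat.num_natCast`, `Rat.den_natCast`, `encodeNat 1 = [true]`). [folklore] -/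
private theorem stubEncode_encodeRat_natCast (K : ℕ) :
    encodingRatBool.encode (K : ℚ) = boolPair (encodeInt (K : ℤ)) [true] := by
  show boolPair (encodeInt (K : ℚ).num) (encodeNat (K : ℚ).den) = _
  rw [Rat.num_natCast, Rat.den_natCast]
  rfl

/-- `|code of (K : ℚ)| ≤ 2 ⌊log₂ K⌋ + 17`. [folklore] -/
private theorem stubEncode_length_rat_le (K : ℕ) :
    (encodingRatBool.encode (K : ℚ)).length ≤ 2 * Nat.log 2 K + 17 := by
  rw [stubEncode_encodeRat_natCast, length_boolPair]
  have h : (encodeInt (K : ℤ)).length ≤ Nat.log 2 (K : ℤ).natAbs + 7 := length_encodeInt_le_holds _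
  rw [Int.natAbs_natCast] at h
  simp only [List.length_singleton]
  omega

/-- Every entry of the block matrix `[[2·I_N, incBlock], [0, 2·I_me]]` has absolute value `≤ 2`
(diagonal blocks: `0` or `2`; incidence block: `0` or `1`; zero block). [folklore] -/
private theorem stubEncode_natAbs_fromBlocks_le (N me : ℕ) (C : Fin me → Clause ℕ)
    (a b : Fin N ⊕ Fin me) :
    (Matrix.fromBlocks (Matrix.diagonal fun _ => (2 : ℤ)) (incBlock N me C) 0
      (Matrix.diagonal fun _ => (2 : ℤ)) a b).natAbs ≤ 2 := by
  rcases a with a | a <;> rcases b with b | b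
  · rw [Matrix.fromBlocks_apply₁₁, Matrix.diagonal_apply]
    split_ifs <;> simp
  · rw [Matrix.fromBlocks_apply₁₂, incBlock, Matrix.of_apply]
    split_ifs <;> simp
  · rw [Matrix.fromBlocks_apply₂₁]
    simp
  · rw [Matrix.fromBlocks_apply₂₂, Matrix.diagonal_apply]
    split_ifs <;> simp

/-- Every entry of `conABasis N me C` has absolute value `≤ 2` (it is a reindexing of the block
matrix above). [folklore] -/
private theorem stubEncode_natAbs_conABasis_le (N me : ℕ) (C : Fin me → Clause ℕ)
    (i j : Fin (N + me)) : (conABasis N me C i j).natAbs ≤ 2 := by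
  unfold conABasis
  rw [Matrix.reindex_apply, Matrix.submatrix_apply]
  exact stubEncode_natAbs_fromBlocks_le N me C _ _

/-- Every entry of `conATarget N me C` has absolute value `≤ 1` (`1` in the message block,
`rhsBit ∈ {0, 1}` in the check block). [folklore] -/
private theorem stubEncode_natAbs_conATarget_le (N me : ℕ) (C : Fin me → Clause ℕ)
    (k : Fin (N + me)) : (conATarget N me C k).natAbs ≤ 1 := by
  unfold conATarget
  cases finSumFinEquiv.symm k with
  | inl a => simp
  | inr e => rcases rhsBit_eq_zero_or_one (C e) with h | h <;> simp [h]

/-- `|code of conABasis N me C| ≤ 2 n² + 2 + 20 n²`, `n = N + me` (row-major `listBool` code of the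
`n²` entries, each of absolute value `≤ 2`; Micciancio–Goldwasser 2002, Ch. 1, §1.3). [folklore] -/
private theorem stubEncode_length_matrix_le (N me : ℕ) (C : Fin me → Clause ℕ) :
    ((encodingIntMatrixFin (N + me)).encode (conABasis N me C)).length ≤
      2 * ((N + me) * (N + me)) + 2 + (N + me) * (N + me) * (2 * 2 + 16) := by
  change (encodingIntBool.listBool.encode (List.ofFn fun m : Fin ((N + me) * (N + me)) =>
    conABasis N me C (finProdFinEquiv.symm m).1 (finProdFinEquiv.symm m).2)).length ≤ _
  exact stubEncode_length_listBool_ofFn_le _ 2 fun m => stubEncode_natAbs_conABasis_le N me C _ _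

/-- `|code of conATarget N me C| ≤ 2 n + 2 + 18 n`, `n = N + me` (`listBool` code of the `n`
entries, each of absolute value `≤ 1`). [folklore] -/
private theorem stubEncode_length_target_le (N me : ℕ) (C : Fin me → Clause ℕ) :
    ((encodingIntVecFin (N + me)).encode (conATarget N me C)).length ≤
      2 * (N + me) + 2 + (N + me) * (2 * 1 + 16) := by
  change (encodingIntBool.listBool.encode (List.ofFn (conATarget N me C))).length ≤ _
  exact stubEncode_length_listBool_ofFn_le _ 1 (stubEncode_natAbs_conATarget_le N me C)

/-! ### The stub -/

/-- **Stub `stub_encode` of the line `Sketch`.** The code of the Construction-A instance with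
natural threshold `K` has length `≤ 100 · ((N + me + 1)² + ⌊log₂ K⌋ + 1)`: with `n = N + me`,
`|code| = 2 (2 |bin n| + 2 + (2 |code B| + 2 + |code t|)) + 2 + |code K|`, where
`|bin n| ≤ n + 3`, `|code B| ≤ 22 n² + 2` (entries in `{0, 1, 2}`), `|code t| ≤ 20 n + 2` (entries
in `{0, 1}`) and `|code K| ≤ 2 ⌊log₂ K⌋ + 17` — the size of the input is polynomial in the
dimension and the bit length of the data (Micciancio–Goldwasser 2002, Ch. 1, §1.3; Arora–Barak
2009, §0.1). [folklore] -/
theorem stub_encode : ∃ c : ℕ, ∀ (N me : ℕ) (C : Fin me → Clause ℕ) (K : ℕ),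
    (GapCVPInstance.encode (conAInstance N me C (K : ℚ))).length ≤
      c * ((N + me + 1) ^ 2 + Nat.log 2 K + 1) := by
  refine ⟨100, fun N me C K => ?_⟩
  rw [stubEncode_encode_eq]
  simp only [length_boolPair]
  have hh := stubEncode_length_encodeNat_le (N + me)
  have hh' := Nat.log_le_self 2 (N + me)
  have hM := stubEncode_length_matrix_le N me C
  have hV := stubEncode_length_target_le N me C
  have hR := stubEncode_length_rat_le K
  have hsq : (N + me + 1) ^ 2 = (N + me) * (N + me) + 2 * (N + me) + 1 := by ring
  rw [hsq]
  omega

end Summit.PneNP.PneNP.Theorems.ConA
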